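import Summits.HubbardSuperconductivity.HubbardSuperconductivity.Theorems.BirComplexStableXY.Negative.WitnessTable
import HarnessLib

/-!
# Crux `BirComplexStableXYR`, line `fat-gaussian-defect-calculus`: stub E5 `stub_spatialBerryZero`

Registered stub (lead c8, wave 8, skeleton `Cruxes/BirComplexStableXYR/Lines/fat_gaussian_defect_calculus.lean`),
helper (`--supports`) for the crux `Summit.HubbardSuperconductivity.HubbardSuperconductivity.Theses.BalabanIR.BirComplexStableXYR`:
**spatial holonomies carry no Berry phase.**

**Statement.** For a finite Fourier table `c : Table r` on the window `W r = Fin r × Fin r × Fin r` (vocabulary of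
`Theorems.BirComplexStableXY.Negative.WitnessTable`) satisfying (U1) `Σ_w n_w = 0` for every `n ∈ supp c`, let the Berry
weights `m : W r → ℝ` be given by `m_w = Σ_n Re(c_n) n_w` (hypothesis `hm`) and assume they are odd under the time
reflection `R (a, b, t) = (a, b, rev t)` (hypothesis `hodd`, supplied by stub E4).  Then
`Σ_w m_w = 0`, `Σ_w m_w · w₁ = 0` and `Σ_w m_w · w₂ = 0`.

**Proof.** (a) `Σ_w m_w = Σ_w Σ_{n ∈ supp c} Re(c_n) n_w = Σ_n Re(c_n) Σ_w n_w = 0` by (U1) (`Finset.sum_comm`,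
`Finset.mul_sum`).  (b) The reflection `R` is an involution of the finite window (`Fin.rev_rev`), hence a bijection, and it
fixes both spatial coordinates; re-indexing the finite sum by it (`Function.Bijective.sum_comp`) and using oddness gives
`S = Σ_w m_{Rw} (Rw)₁ = −Σ_w m_w w₁ = −S`, so `S = 0`; the same for `w₂`.  Elementary finite-sum bookkeeping; no
definition and no named fact is introduced; sorry-free. [folklore]
-/

set_option linter.dupNamespace false -- `Summit.<S>.<S>.Theorems…` repeats the summit name (D-0017 layout)

namespace Summit.HubbardSuperconductivity.HubbardSuperconductivity.Theorems.FSUnfolding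

open scoped BigOperators
open Literature.Probability.LatticeModels
open Summit.HubbardSuperconductivity.BirComplexStableXYNegative

/-- **A finite sum of a function odd under an involution vanishes.**  If `R` is an involution of a finite type and
`f (R a) = −f a` for all `a`, then `Σ_a f a = 0` (re-index by the bijection `R`). [folklore] -/
theorem spatialBerry_sum_eq_zero_of_odd {α : Type*} [Fintype α] (R : α → α) (hR : Function.Involutive R)
    (f : α → ℝ) (hf : ∀ a, f (R a) = -f a) : ∑ a, f a = 0 := by
  have h := hR.bijective.sum_comp f
  simp only [hf, Finset.sum_neg_distrib] at h
  linarith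

/-- The time reflection `R (a, b, t) = (a, b, rev t)` of the window `W r` is an involution. [folklore] -/
theorem spatialBerry_reflect_involutive (r : ℕ) :
    Function.Involutive (fun w : W r => ((w.1, w.2.1, Fin.rev w.2.2) : W r)) := by
  intro w
  simp [Fin.rev_rev]

/-- **(U1) kills the total Berry weight.**  If every frequency in the support of `c` is charge neutral
(`Σ_w n_w = 0`) then `Σ_w Σ_n Re(c_n) n_w = 0` (exchange the two finite sums). [folklore] -/
theorem spatialBerry_total_eq_zero {r : ℕ} (c : Table r) (hU1 : ∀ n ∈ c.support, ∑ w, n w = 0) :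
    ∑ w : W r, c.sum (fun n a => a.re * (n w : ℝ)) = 0 := by
  calc ∑ w : W r, c.sum (fun n a => a.re * (n w : ℝ))
        = ∑ w : W r, ∑ n ∈ c.support, (c n).re * (n w : ℝ) := rfl
    _ = ∑ n ∈ c.support, ∑ w : W r, (c n).re * (n w : ℝ) := Finset.sum_comm
    _ = ∑ n ∈ c.support, (c n).re * ∑ w : W r, (n w : ℝ) :=
        Finset.sum_congr rfl fun n _ => (Finset.mul_sum _ _ _).symm
    _ = 0 := Finset.sum_eq_zero fun n hn => by
        have h0 : (∑ w : W r, (n w : ℝ)) = 0 := by exact_mod_cast hU1 n hn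
        rw [h0, mul_zero]

/-- **Registered stub E5 `stub_spatialBerryZero` (verbatim signature): spatial holonomies carry no Berry phase.**
If the Berry weights `m_w = Σ_n Re(c_n) n_w` are odd under the time reflection `R (a, b, t) = (a, b, rev t)` (stub E4)
then, with (U1) (`Σ_w m_w = Σ_n Re(c_n)·Σ_w n_w = 0`), their first spatial moments vanish:
`Σ_w m_w w₁ = Σ_w m_w w₂ = 0` (pair `w` with `Rw`, which has the same spatial coordinates).  Hence only the
temporal holonomy is tilted by the Berry phase. [folklore] -/
theorem stub_spatialBerryZero :
    ∀ (r : ℕ) (c : Table r), (∀ n ∈ c.support, ∑ w, n w = 0) →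
      ∀ (m : W r → ℝ), (∀ w : W r, m w = c.sum (fun n a => a.re * (n w : ℝ))) →
      (∀ w : W r, m (w.1, w.2.1, Fin.rev w.2.2) = -m w) →
      (∑ w : W r, m w = 0) ∧ (∑ w : W r, m w * ((w.1 : ℕ) : ℝ) = 0) ∧ (∑ w : W r, m w * ((w.2.1 : ℕ) : ℝ) = 0) := by
  intro r c hU1 m hm hodd
  refine ⟨?_, ?_, ?_⟩
  · -- (a) total weight: exchange the sums and use (U1)
    rw [Finset.sum_congr rfl fun w _ => hm w]
    exact spatialBerry_total_eq_zero c hU1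
  · -- (b) first spatial moment: `R` fixes `w.1` and flips the sign of `m`
    refine spatialBerry_sum_eq_zero_of_odd _ (spatialBerry_reflect_involutive r) _ fun w => ?_
    dsimp only
    rw [hodd w, neg_mul]
  · -- (c) second spatial moment: `R` fixes `w.2.1` and flips the sign of `m`
    refine spatialBerry_sum_eq_zero_of_odd _ (spatialBerry_reflect_involutive r) _ fun w => ?_
    dsimp only
    rw [hodd w, neg_mul]

end Summit.HubbardSuperconductivity.HubbardSuperconductivity.Theorems.FSUnfolding
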